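import Summits.ResolutionOfSingularities.ResolutionOfSingularities.Theorems.WeightedInvariantIota3FlagBridge
import Summits.ResolutionOfSingularities.ResolutionOfSingularities.Theorems.WeightedInvariantHypersurfaceLocalGameEFTDimTwoNewton
import HarnessLib

/-!
# (o56)(b′) ring side, PART 1 of 6 — RATIONAL CONTACT: the one-flag collapse `ratContactFiltration`, the tangent-cone dichotomy, the arithmetic
# core (`witness_lands_low`, `no_canceller`), the bound notions `SuccessorRatioBound` / `OneFlagRatioBound`, frame-independence

**Provenance / honest framing.** This is a VERBATIM PORT (proofs unchanged; namespace `…LocalEngine.Iota3.RatContact` instead of the sketch's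
`…Iota3.R9`) of res-L1-w43-idea-2's kernel-checked sketch `Cruxes/WeightedConstruction/SketchL1w43Idea2R9.lean` (Sketch-R9, gen 9, tree copy
657de2227c79926d; §14e as announced f30a0aee35c844fc), board item (o56-R9) of res-L1-w43-plan-1 (dealer word STATUS l.69360), res-plan-2 IDLE POOL
DEAL #52 (2); ported by res-L1-type-o4 so that `Theorems/` files (res-type-057's (D1) bundle for the door item `stmt-ResolutionOfSingularities-19897`
branch (o56)(b′)) can import it; `--supports stmt-ResolutionOfSingularities-0571 --as helper`. [OURS · L1 w43 · idea-2 R9] Every statement here is OURS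
elementary commutative algebra over Mathlib and the tree's `flagContactFiltration` / `weightedMonomialIdeal` / unit-expansion calculus; every `def` is an
OURS notion of the sketch (NOT a statement of H. Hironaka's 2017 manuscript, which is under adjudication and is neither asserted nor used); no Literature
fact is introduced; AI-written and AI-ported, weaker than expert review; nothing here is progress on resolution of singularities in positive characteristic.

## Contents (Sketch-R9 §2, §3, §5, §6 verbatim)
* §2 ONE-FLAG COLLAPSE: `ratContactFiltration g a b n := ⨆ α, (g^α)·𝔪^⌈(n − aα)/b⌉`; at `q = r₂` the tree's `flagContactFiltration` collapses to it
  (`flagContactFiltration_eq_ratContactFiltration`), hence `FlagReaches → OneFlagReaches` for admissible triples.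
* §3 TANGENT-CONE DICHOTOMY: `ratContactFiltration g a b (aν) ≤ (g^ν) ⊔ 𝔪^(ν+1)` for `b < a`.
* §5 ARITHMETIC CORE: `witness_lands_low`, `witness_margin`, `low_bound_le_ratio`, `no_canceller`; the Props `SuccessorRatioBound` (two-flag) and
  `OneFlagRatioBound` (one-flag, implies the former); `sigmaRatioNat_mul_lt_of_slope_lt` / `sigma_ratio_drop_of_bounds` (slope bound ⇒ strict letter drop).
* §6 FRAME-INDEPENDENCE of the certificate ideal (`weightedMonomialIdeal_eq_ratContactFiltration`, `weightedMonomialIdeal_frame_independent`).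
-/

noncomputable section

open IsLocalRing Literature.AlgebraicGeometry.Resolution

set_option linter.dupNamespace false

namespace Summit.ResolutionOfSingularities.ResolutionOfSingularities.Cruxes.HypersurfaceCentreConstruction.LocalEngine

namespace Iota3

namespace RatContact

universe u

variable {S : Type u} [CommRing S] [IsLocalRing S]

/-! ## §2 The one-flag collapse at `q = r₂` -/

/-- [OURS · R9-B1] The **rational one-flag contact filtration** of weight `a/b` along `g`:
degree `n` is `⨆_α (g^α) · 𝔪^⌈(n − aα)/b⌉` — the monomials `u^γ g^α` with `|γ| + (a/b)α ≥ n/b`.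
For `b = 1` it is 092's `contactFiltration g a`.  A predicate of the line, not a cited statement. -/
def ratContactFiltration (g : S) (a b n : ℕ) : Ideal S :=
  ⨆ α : ℕ, Ideal.span {g ^ α} * maximalIdeal S ^ ((n - a * α + b - 1) / b)

/-- The `rfl` unfolding. [folklore] -/
theorem ratContactFiltration_def (g : S) (a b n : ℕ) :
    ratContactFiltration g a b n = ⨆ α : ℕ, Ideal.span {g ^ α} * maximalIdeal S ^ ((n - a * α + b - 1) / b) := rfl

/-- The ceiling bookkeeping of the collapse: with `q ≤ r₂` and `e = ⌈(N − r₂β)/q⌉` one has `⌈N/r₂⌉ ≤ β + e`. [folklore] -/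
theorem ceil_collapse {N q r₂ β : ℕ} (hq : 0 < q) (hqr : q ≤ r₂) :
    (N + r₂ - 1) / r₂ ≤ β + (N - r₂ * β + q - 1) / q := by
  have hr : 0 < r₂ := lt_of_lt_of_le hq hqr
  obtain ⟨e, he⟩ : ∃ e, e = (N - r₂ * β + q - 1) / q := ⟨_, rfl⟩
  rw [← he]
  have h1 : N - r₂ * β ≤ e * q := by
    have := Nat.lt_div_mul_add (a := N - r₂ * β + q - 1) hq
    rw [← he] at this
    omega
  have h2 : e * q ≤ e * r₂ := Nat.mul_le_mul_left e hqr
  apply Nat.le_of_lt_succ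
  rw [Nat.div_lt_iff_lt_mul hr]
  have h3 : (β + e + 1) * r₂ = r₂ * β + e * r₂ + r₂ := by ring
  rw [Nat.succ_eq_add_one, h3]
  omega

/-- [OURS · R9-B1] **One-flag collapse, `≤`**: for `g₂ ∈ 𝔪` and `0 < q ≤ r₂` the two-flag filtration lies in the rational
one-flag filtration of `g₁` — the factor `g₂^β` is worth at least `𝔪^β`, and `β + ⌈(N − r₂β)/q⌉ ≥ ⌈N/r₂⌉`. [folklore] -/
theorem flagContactFiltration_le_ratContactFiltration {g₁ g₂ : S} (hg₂ : g₂ ∈ maximalIdeal S) {q r₁ r₂ : ℕ}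
    (hq : 0 < q) (hqr : q ≤ r₂) (n : ℕ) :
    flagContactFiltration g₁ g₂ q r₁ r₂ n ≤ ratContactFiltration g₁ r₁ r₂ n := by
  rw [flagContactFiltration_def, ratContactFiltration_def]
  refine iSup_le fun α => iSup_le fun β => le_iSup_of_le α ?_
  have hpow : g₂ ^ β ∈ maximalIdeal S ^ β := Ideal.pow_mem_pow hg₂ β
  calc Ideal.span {g₁ ^ α * g₂ ^ β} * maximalIdeal S ^ ((n - r₁ * α - r₂ * β + q - 1) / q)
      = Ideal.span {g₁ ^ α} * (Ideal.span {g₂ ^ β} * maximalIdeal S ^ ((n - r₁ * α - r₂ * β + q - 1) / q)) := by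
        rw [← Ideal.span_singleton_mul_span_singleton, mul_assoc]
    _ ≤ Ideal.span {g₁ ^ α} * (maximalIdeal S ^ β * maximalIdeal S ^ ((n - r₁ * α - r₂ * β + q - 1) / q)) :=
        Ideal.mul_mono_right (Ideal.mul_mono_left ((Ideal.span_singleton_le_iff_mem _).mpr hpow))
    _ ≤ Ideal.span {g₁ ^ α} * maximalIdeal S ^ ((n - r₁ * α + r₂ - 1) / r₂) := by
        refine Ideal.mul_mono_right ?_
        rw [← pow_add]
        exact Ideal.pow_le_pow_right (ceil_collapse (N := n - r₁ * α) hq hqr)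

/-- [OURS · R9-B1] **One-flag collapse, `≥`**: the rational one-flag filtration is the `β = 0` part of the two-flag filtration
at `q = r₂`. [folklore] -/
theorem ratContactFiltration_le_flagContactFiltration (g₁ g₂ : S) (r₁ r₂ n : ℕ) :
    ratContactFiltration g₁ r₁ r₂ n ≤ flagContactFiltration g₁ g₂ r₂ r₁ r₂ n := by
  rw [flagContactFiltration_def, ratContactFiltration_def]
  refine iSup_le fun α => le_iSup_of_le α (le_iSup_of_le 0 ?_)
  rw [pow_zero, mul_one, Nat.mul_zero, Nat.sub_zero]

/-- [OURS · R9-B1] **One-flag collapse, `=`** at `q = r₂` (for `g₂ ∈ 𝔪`, `0 < r₂`). [folklore] -/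
theorem flagContactFiltration_eq_ratContactFiltration {g₁ g₂ : S} (hg₂ : g₂ ∈ maximalIdeal S) {r₁ r₂ : ℕ}
    (hr : 0 < r₂) (n : ℕ) : flagContactFiltration g₁ g₂ r₂ r₁ r₂ n = ratContactFiltration g₁ r₁ r₂ n :=
  le_antisymm (flagContactFiltration_le_ratContactFiltration hg₂ hr le_rfl n)
    (ratContactFiltration_le_flagContactFiltration g₁ g₂ r₁ r₂ n)

/-- [OURS · R9-B1] `f` (of order `ν`) reaches the rational weight `a/b` along ONE regular parameter `g`. A predicate of the
line, not a cited statement. -/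
def OneFlagReaches (f : S) (ν a b : ℕ) : Prop :=
  ∃ g : S, g ∈ maximalIdeal S ∧ g ∉ maximalIdeal S ^ 2 ∧ f ∈ ratContactFiltration g a b (a * ν)

/-- [OURS · R9-B1] **The sup over two-flags is a sup over one regular parameter**: an admissible triple reached by a two-flag
is reached (same `r₁, r₂`) by its first member alone. [folklore] -/
theorem FlagReaches.oneFlagReaches {f : S} {ν q r₁ r₂ : ℕ} (hadm : AdmissibleTriple q r₁ r₂)
    (h : FlagReaches f ν q r₁ r₂) : OneFlagReaches f ν r₁ r₂ := by
  obtain ⟨g₁, g₂, hfl, hf⟩ := h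
  exact ⟨g₁, hfl.1, hfl.left_not_mem_sq, flagContactFiltration_le_ratContactFiltration hfl.2.1 hadm.1 hadm.2.1 _ hf⟩

/-- [OURS · R9-B1] Conversely a one-flag reach along `g` with ANY two-flag partner `g₂` is a two-flag reach at `q = b`.
[folklore] -/
theorem flagReaches_of_mem_ratContactFiltration {f g g₂ : S} {ν a b : ℕ} (hfl : IsTwoFlag g g₂)
    (h : f ∈ ratContactFiltration g a b (a * ν)) : FlagReaches f ν b a b :=
  ⟨g, g₂, hfl, ratContactFiltration_le_flagContactFiltration g g₂ a b _ h⟩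

/-! ## §3 The tangent-cone dichotomy -/

/-- The exponent bookkeeping: for `b < a`, `α < ν`: `ν + 1 ≤ α + ⌈a(ν − α)/b⌉`. [folklore] -/
theorem succ_le_add_ceil {a b ν α : ℕ} (hb : 0 < b) (hab : b < a) (hα : α < ν) :
    ν + 1 ≤ α + (a * ν - a * α + b - 1) / b := by
  obtain ⟨e, he⟩ : ∃ e, e = (a * ν - a * α + b - 1) / b := ⟨_, rfl⟩
  rw [← he]
  have hX1 : a * ν - a * α = a * (ν - α) := (mul_tsub a ν α).symm
  have hX : (b + 1) * (ν - α) ≤ a * (ν - α) := Nat.mul_le_mul_right _ hab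
  have hceil : a * ν - a * α + b - 1 < e * b + b := by
    have := Nat.lt_div_mul_add (a := a * ν - a * α + b - 1) hb
    rwa [← he] at this
  by_contra hlt
  have hlt' : α + e < ν + 1 := Nat.lt_of_not_le hlt
  have h4 : e * b ≤ (ν - α) * b := Nat.mul_le_mul_right _ (by omega)
  have h5 : (b + 1) * (ν - α) = (ν - α) * b + (ν - α) := by ring
  omega

/-- [OURS · R9-B1′] **Tangent-cone dichotomy**: for `g ∈ 𝔪` and `b < a`,
`ratContactFiltration g a b (aν) ≤ (g^ν) ⊔ 𝔪^(ν+1)`: pieces with `α ≥ ν` are multiples of `g^ν`, pieces with `α < ν` lie in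
`𝔪^(α + ⌈a(ν−α)/b⌉) ⊆ 𝔪^(ν+1)`.  Consequence: a contact ratio `> 1` along `g` forces `in_𝔪(f) = c · ḡ^ν`, so at most ONE tangent
hyperplane direction carries ratio `> 1` (the others have ratio exactly `1`). [folklore] -/
theorem ratContactFiltration_le_span_pow_sup {g : S} (hg : g ∈ maximalIdeal S) {a b : ℕ} (hb : 0 < b) (hab : b < a)
    (ν : ℕ) : ratContactFiltration g a b (a * ν) ≤ Ideal.span {g ^ ν} ⊔ maximalIdeal S ^ (ν + 1) := by
  rw [ratContactFiltration_def]
  refine iSup_le fun α => ?_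
  by_cases hα : ν ≤ α
  · refine le_sup_of_le_left ?_
    calc Ideal.span {g ^ α} * maximalIdeal S ^ ((a * ν - a * α + b - 1) / b) ≤ Ideal.span {g ^ α} := Ideal.mul_le_right
      _ ≤ Ideal.span {g ^ ν} := Ideal.span_singleton_le_span_singleton.mpr (pow_dvd_pow g hα)
  · have hα : α < ν := Nat.lt_of_not_le hα
    refine le_sup_of_le_right ?_
    calc Ideal.span {g ^ α} * maximalIdeal S ^ ((a * ν - a * α + b - 1) / b)
        ≤ maximalIdeal S ^ α * maximalIdeal S ^ ((a * ν - a * α + b - 1) / b) :=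
          Ideal.mul_mono_left ((Ideal.span_singleton_le_iff_mem _).mpr (Ideal.pow_mem_pow hg α))
      _ = maximalIdeal S ^ (α + (a * ν - a * α + b - 1) / b) := (pow_add _ _ _).symm
      _ ≤ maximalIdeal S ^ (ν + 1) := Ideal.pow_le_pow_right (succ_le_add_ceil hb hab hα)

/-- [OURS · R9-B1′] The dichotomy as an initial-form statement: `f ∈ ratContactFiltration g a b (aν)` with `b < a` gives
`f − c·g^ν ∈ 𝔪^(ν+1)` for some `c`. [folklore] -/
theorem exists_sub_mul_pow_mem_of_mem_ratContactFiltration {f g : S} (hg : g ∈ maximalIdeal S) {a b ν : ℕ}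
    (hb : 0 < b) (hab : b < a) (h : f ∈ ratContactFiltration g a b (a * ν)) :
    ∃ c : S, f - c * g ^ ν ∈ maximalIdeal S ^ (ν + 1) := by
  have h' := ratContactFiltration_le_span_pow_sup hg hb hab ν h
  rw [Submodule.mem_sup] at h'
  obtain ⟨y, hy, z, hz, hyz⟩ := h'
  obtain ⟨c, rfl⟩ := Ideal.mem_span_singleton'.mp hy
  exact ⟨c, by rwa [show f - c * g ^ ν = z by rw [← hyz]; ring]⟩

/-- [OURS · R9-B1′] Contrapositive, the form used at a successor point: if NO `c` makes `f − c·g^ν ∈ 𝔪^(ν+1)` (the tangent cone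
of `f` is not the `ν`-fold hyperplane `ḡ = 0`), then `g` reaches no weight `a/b > 1`. [folklore] -/
theorem not_mem_ratContactFiltration_of_tangent {f g : S} (hg : g ∈ maximalIdeal S) {a b ν : ℕ} (hb : 0 < b)
    (hab : b < a) (hne : ∀ c : S, f - c * g ^ ν ∉ maximalIdeal S ^ (ν + 1)) :
    f ∉ ratContactFiltration g a b (a * ν) := fun h => by
  obtain ⟨c, hc⟩ := exists_sub_mul_pow_mem_of_mem_ratContactFiltration hg hb hab h
  exact hne c hc

/-! ## §5 The arithmetic core of (o56)(b′)

Setting of (b′) at the generic point `η` of the curve `C = V(x, y)`: frame `(x, y, z)`, `f = c₀y^ν + Σ c·y^j x^i z^k`, `δ_η = r/q`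
with `q ≥ 2`, `q ∤ r`, `b = ⌊r/q⌋`, `ρ = r − qb ∈ [1, q−1]`; the frame is `δ_η`-prepared: every monomial has `q·i ≥ r·(ν − j)`.
`τ = 0` supplies a WITNESS monomial with `q·i + k < (r+1)(ν−j)`.  The t-homogeneous successor prime with a `(ν, ε)`-tie is the
origin `𝔫₀` of the `x`-chart `x = t, y = t^b Y, z = z`, where the monomial becomes `Y^j t^(i − b(ν−j)) z^k`, a point
`((i − b(ν−j))/(ν−j), k/(ν−j))` of `Δ(f₁; t, z; Y)`.  The lemmas: (i) the witness lands at `|·| < 1 + ρ/q` (`< 2`, and `≤ r/q` as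
`b ≥ 1`); (ii) a monomial that could cancel a `|·|`-minimal witness of maximal `j` under a translation `Y ↦ Y − ψ`, `ψ ∈ (t, z)²`,
is itself a witness with larger `j` — so the witness survives every frame change tangent to `Y`, and with §2–§3 the successor's
`σ₁/ν!` is `< 1 + ρ/q ≤ r/q = σ₁(η)/ν!`: **(b′) holds with the explicit margin**. -/

/-- [OURS · R9-B3 · (i)] **The witness lands low**: from `q i ≥ r m` (prepared), `q i + k < (r+1) m` (τ-witness), `q b ≤ r`
(`b = ⌊r/q⌋`) one gets `q·((i − b m) + k) < (r + q − q b)·m`, i.e. the successor point has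
`|·| = ((i − bm) + k)/m < 1 + ρ/q`.  (`m = ν − j ≥ 1`.) [folklore] -/
theorem witness_lands_low {q r b i k m : ℕ} (hq : 0 < q) (hqb : q * b ≤ r) (hprep : r * m ≤ q * i)
    (hwit : q * i + k < (r + 1) * m) (hbm : b * m ≤ i) : q * ((i - b * m) + k) < (r + q - q * b) * m := by
  obtain ⟨i', rfl⟩ : ∃ i', i = b * m + i' := ⟨i - b * m, by omega⟩
  obtain ⟨ρ, rfl⟩ : ∃ ρ, r = q * b + ρ := ⟨r - q * b, by omega⟩
  have e1 : b * m + i' - b * m = i' := by omega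
  have e2 : q * b + ρ + q - q * b = ρ + q := by omega
  rw [e1, e2]
  have H1 : (q * b + ρ) * m = q * (b * m) + ρ * m := by ring
  have H2 : q * (b * m + i') = q * (b * m) + q * i' := by ring
  have H3 : (q * b + ρ + 1) * m = q * (b * m) + ρ * m + m := by ring
  have H4 : q * (i' + k) = q * i' + q * k := by ring
  have H5 : (ρ + q) * m = ρ * m + q * m := by ring
  rw [H1, H2] at hprep
  rw [H2, H3] at hwit
  rw [H4, H5]
  have hk : k + (q * i' - ρ * m) + 1 ≤ m := by omega
  have hmul := Nat.mul_le_mul_left q hk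
  have H6 : q * (k + (q * i' - ρ * m) + 1) = q * k + q * (q * i' - ρ * m) + q := by ring
  rw [H6] at hmul
  have H7 : q * i' - ρ * m ≤ q * (q * i' - ρ * m) := Nat.le_mul_of_pos_left _ hq
  omega

/-- [OURS · R9-B3 · (i⁺) MARGIN LAW] The sharper form found by the R9 census (2376/2376 ties, 752 equalities) and then proved:
the witness point lands at value `≤ 1 + ρ/q − 1/m` (`m = ν − j⋆ ≤ ν`), i.e. `q·((i − b m) + k) + q ≤ (r + q − q b)·m` — so the successor's
ratio is `≤ 1 + frac(r/q) − 1/ν`, with equality iff `j⋆ = 0` and `q ∣ ρν` (family `y^ν + x^{rν/q} z^{ν−1}`).  Key: `k < m` is automatic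
(`q i ≥ r m` and `q i + k < (r+1) m`). [folklore] -/
theorem witness_margin {q r b i k m : ℕ} (hq : 0 < q) (hqb : q * b ≤ r) (hprep : r * m ≤ q * i)
    (hwit : q * i + k < (r + 1) * m) (hbm : b * m ≤ i) : q * ((i - b * m) + k) + q ≤ (r + q - q * b) * m := by
  obtain ⟨i', rfl⟩ : ∃ i', i = b * m + i' := ⟨i - b * m, by omega⟩
  obtain ⟨ρ, rfl⟩ : ∃ ρ, r = q * b + ρ := ⟨r - q * b, by omega⟩
  have e1 : b * m + i' - b * m = i' := by omega
  have e2 : q * b + ρ + q - q * b = ρ + q := by omega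
  rw [e1, e2]
  have H1 : (q * b + ρ) * m = q * (b * m) + ρ * m := by ring
  have H2 : q * (b * m + i') = q * (b * m) + q * i' := by ring
  have H3 : (q * b + ρ + 1) * m = q * (b * m) + ρ * m + m := by ring
  have H4 : q * (i' + k) = q * i' + q * k := by ring
  have H5 : (ρ + q) * m = ρ * m + q * m := by ring
  rw [H1, H2] at hprep
  rw [H2, H3] at hwit
  rw [H4, H5]
  have hk : k + (q * i' - ρ * m) + 1 ≤ m := by omega
  have hmul := Nat.mul_le_mul_left q hk
  have H6 : q * (k + (q * i' - ρ * m) + 1) = q * k + q * (q * i' - ρ * m) + q := by ring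
  rw [H6] at hmul
  have H7 : q * i' - ρ * m ≤ q * (q * i' - ρ * m) := Nat.le_mul_of_pos_left _ hq
  omega

/-- [OURS · R9-B3 · (i′)] … and `1 + ρ/q ≤ r/q` as soon as `b ≥ 1` (`r > q`): `r + q − q b ≤ r`. [folklore] -/
theorem low_bound_le_ratio {q r b : ℕ} (hb : 1 ≤ b) (hqb : q * b ≤ r) : r + q - q * b ≤ r := by
  have : q ≤ q * b := Nat.le_mul_of_pos_right q hb
  omega

/-- [OURS · R9-B3 · (ii)] **Low points are translation-rigid** (the cancellation count).  Points are `(j, a, c)` =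
`Y^j t^a z^c` with `j < ν`, value `|·| = (a + c)/(ν − j)`; «low» means `q(a + c) < (q + ρ)(ν − j)` (i.e. `|·| < 1 + ρ/q`), and
`ρ < q`.  If `(j⋆, a⋆, c⋆)` is low and `|·|`-minimal among the points (`(a⋆ + c⋆)(ν − j) ≤ (a + c)(ν − j⋆)` for every point), then
any point `(j, a, c)` with `j⋆ < j < ν`, `a ≤ a⋆`, `c ≤ c⋆` and `(a⋆ − a) + (c⋆ − c) ≥ 2(j − j⋆)` — the only ones whose product
with a monomial of `ψ^(j − j⋆)`, `ψ ∈ (t,z)²`, can hit `Y^{j⋆} t^{a⋆} z^{c⋆}` — does not exist.  Pure arithmetic. [folklore] -/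
theorem no_canceller {q ρ ν j₀ a₀ c₀ j a c : ℕ} (hρ : ρ < q) (hj₀ : j₀ < j) (hj : j < ν)
    (hlow : q * (a₀ + c₀) < (q + ρ) * (ν - j₀))
    (hmin : (a₀ + c₀) * (ν - j) ≤ (a + c) * (ν - j₀))
    (ha : a ≤ a₀) (hc : c ≤ c₀) (hdeg : 2 * (j - j₀) ≤ (a₀ - a) + (c₀ - c)) : False := by
  -- Write s₀ = a₀ + c₀, s = a + c, m₀ = ν − j₀, m = ν − j, d = j − j₀ = m₀ − m > 0.
  -- hdeg: s ≤ s₀ − 2d;  hmin: s₀ m ≤ s m₀;  hlow: q s₀ < (q+ρ) m₀ < 2q m₀, i.e. s₀ < 2 m₀.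
  -- Then s₀ m ≤ s m₀ ≤ (s₀ − 2d) m₀ = s₀ m₀ − 2 d m₀, so 2 d m₀ ≤ s₀ (m₀ − m) = s₀ d, so 2 m₀ ≤ s₀: contradiction.
  obtain ⟨d, hd⟩ : ∃ d, j = j₀ + d := ⟨j - j₀, by omega⟩
  subst hd
  have hdpos : 0 < d := by omega
  have hm : ν - j₀ = (ν - (j₀ + d)) + d := by omega
  set m := ν - (j₀ + d) with hm_def
  rw [hm] at hlow hmin
  have hs : a + c + 2 * d ≤ a₀ + c₀ := by omega
  have h2 : (q + ρ) * (m + d) < 2 * q * (m + d) := by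
    have : 0 < m + d := by omega
    nlinarith
  have h3 : q * (a₀ + c₀) < 2 * q * (m + d) := lt_trans hlow h2
  have h4 : a₀ + c₀ < 2 * (m + d) := by
    have hq : 0 < q := by omega
    nlinarith
  -- hmin : (a₀ + c₀) * m ≤ (a + c) * (m + d) ≤ (a₀ + c₀ − 2d)(m + d)
  have h5 : (a₀ + c₀) * m + 2 * d * (m + d) ≤ (a₀ + c₀) * (m + d) := by nlinarith
  have h6 : 2 * d * (m + d) ≤ (a₀ + c₀) * d := by nlinarith
  have h7 : 2 * (m + d) ≤ a₀ + c₀ := by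
    have := Nat.le_of_mul_le_mul_right (by nlinarith : 2 * (m + d) * d ≤ (a₀ + c₀) * d) hdpos
    exact this
  omega

/-- [OURS · R9-B3 · CANDIDATE] **The successor ratio bound of (b′)**, typed as a shape over the letters: at a local ring `S₁`
(the t-homogeneous successor germ) whose `f₁` has order `ν`, tangent cone `c₀·Ȳ^ν`-or-not, and whose frame `(Y, t, z)` carries a
low rigid witness, every admissible triple reached has `r₁·q < (q + ρ)·r₂`; hence `sigmaRatioNat f₁ < ν!·(q + ρ)/q ≤ ν!·r/q`.
The hypotheses are those §2–§3 reduce it to; the monomial bookkeeping (`Δ(f₁; t, z; Y − ψ)` keeps the witness, by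
`no_canceller`) is the part a door typer must supply over `MvPowerSeries`/the completion. -/
def SuccessorRatioBound (S₁ : Type u) [CommRing S₁] [IsLocalRing S₁] (f₁ : S₁) (ν q ρ : ℕ) : Prop :=
  ∀ q' r₁ r₂ : ℕ, AdmissibleTriple q' r₁ r₂ → FlagReaches f₁ ν q' r₁ r₂ → r₁ * q < (q + ρ) * r₂

/-- [OURS · R9 · §15] The **one-flag ratio bound**: every `g ∈ 𝔪` (regular or not) and every weight `a/b ≥ 1` with
`f₁ ∈ RC(g; a, b; aν)` has `a·q < (q+ρ)·b`.  It implies `SuccessorRatioBound` (one-flag collapse, §2) and — unlike the two-flag form —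
it DESCENDS along ring maps (`OneFlagRatioBound.of_map`, §15): the torus direction of the door's successor germs costs nothing.
A predicate of the line, not a cited statement. -/
def OneFlagRatioBound (S₁ : Type u) [CommRing S₁] [IsLocalRing S₁] (f₁ : S₁) (ν q ρ : ℕ) : Prop :=
  ∀ g ∈ maximalIdeal S₁, ∀ a b : ℕ, 0 < b → b ≤ a → f₁ ∈ ratContactFiltration g a b (a * ν) → a * q < (q + ρ) * b

/-- [OURS · R9 · §15] The one-flag bound implies the two-flag (`σ₁`) bound (one-flag collapse `FlagReaches.oneFlagReaches`). [folklore] -/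
theorem OneFlagRatioBound.successorRatioBound {S₁ : Type u} [CommRing S₁] [IsLocalRing S₁] {f₁ : S₁} {ν q ρ : ℕ}
    (h : OneFlagRatioBound S₁ f₁ ν q ρ) : SuccessorRatioBound S₁ f₁ ν q ρ := by
  intro q' r₁ r₂ hadm hfl
  obtain ⟨g, hg, -, hmem⟩ := FlagReaches.oneFlagReaches hadm hfl
  exact h g hg r₁ r₂ (lt_of_lt_of_le hadm.1 hadm.2.1) hadm.2.2 hmem

/-- [OURS · R9-B3] **From the successor slope bound to the letter** (PROVED, `sSup` bookkeeping): if every admissible triple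
reached by `f₁` (at its own order) has slope `r₁/r₂ < (q+ρ)/q`, then `σ₁(f₁)·q < ν!·(q+ρ)` — STRICT, also in the junk case (empty
set, `σ₁ = 0`).  With `q + ρ ≤ r` (`b ≥ 1`, `low_bound_le_ratio`) and `σ₁(η)·q ≥ ν!·r` (the curve's own flag) this is the strict
σ-RATIO drop of (b′). [folklore] -/
theorem sigmaRatioNat_mul_lt_of_slope_lt {S₁ : Type u} [CommRing S₁] [IsLocalRing S₁] (f₁ : S₁) {q ρ : ℕ} (hq : 0 < q)
    (h : SuccessorRatioBound S₁ f₁ (adicOrder f₁).toNat q ρ) :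
    sigmaRatioNat f₁ * q < ratioScale (adicOrder f₁).toNat * (q + ρ) := by
  set F := ratioScale (adicOrder f₁).toNat with hF
  have hFpos : 0 < F := Nat.factorial_pos _
  set A : Set ℕ := {m : ℕ | ∃ q' r₁ r₂ : ℕ, AdmissibleTriple q' r₁ r₂ ∧ FlagReaches f₁ (adicOrder f₁).toNat q' r₁ r₂ ∧
    m * r₂ ≤ ratioScale (adicOrder f₁).toNat * r₁} with hA
  have hσ : sigmaRatioNat f₁ = sSup A := rfl
  -- every member obeys the strict bound
  have hbound : ∀ m ∈ A, m * q < F * (q + ρ) := by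
    rintro m ⟨q', r₁, r₂, hadm, hfr, hm⟩
    have hr₂ : 0 < r₂ := lt_of_lt_of_le hadm.1 hadm.2.1
    have h1 : r₁ * q < (q + ρ) * r₂ := h q' r₁ r₂ hadm hfr
    have h2 : m * q * r₂ ≤ F * (r₁ * q) := by
      have := Nat.mul_le_mul_right q hm
      calc m * q * r₂ = m * r₂ * q := by ring
        _ ≤ F * r₁ * q := this
        _ = F * (r₁ * q) := by ring
    have h3 : F * (r₁ * q) < F * ((q + ρ) * r₂) := Nat.mul_lt_mul_of_pos_left h1 hFpos
    have h4 : m * q * r₂ < F * (q + ρ) * r₂ := by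
      calc m * q * r₂ < F * ((q + ρ) * r₂) := lt_of_le_of_lt h2 h3
        _ = F * (q + ρ) * r₂ := by ring
    exact Nat.lt_of_mul_lt_mul_right h4
  by_cases hne : A.Nonempty
  · have hbdd : BddAbove A := by
      refine ⟨F * (q + ρ), fun m hm => ?_⟩
      have := hbound m hm
      calc m ≤ m * q := Nat.le_mul_of_pos_right m hq
        _ ≤ F * (q + ρ) := this.le
    rw [hσ]
    exact hbound _ (Nat.sSup_mem hne hbdd)
  · rw [Set.not_nonempty_iff_eq_empty] at hne
    rw [hσ, hne, csSup_empty, Nat.bot_eq_zero, zero_mul]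
    exact Nat.mul_pos hFpos (by omega)

/-- [OURS · R9-B3] The (b′) comparison in scaled integers: successor letter `< ν!·(q+ρ)/q ≤ ν!·r/q ≤` the curve's letter. [folklore] -/
theorem sigma_ratio_drop_of_bounds {σ₀ σ₁ F q ρ r : ℕ} (hsucc : σ₁ * q < F * (q + ρ)) (hqr : q + ρ ≤ r)
    (hcurve : F * r ≤ σ₀ * q) : σ₁ < σ₀ := by
  have h1 : F * (q + ρ) ≤ F * r := Nat.mul_le_mul_left F hqr
  have h2 : σ₁ * q < σ₀ * q := lt_of_lt_of_le hsucc (h1.trans hcurve)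
  exact Nat.lt_of_mul_lt_mul_right h2

/-! ## §6 (G5) Frame-independence of the certificate ideal

For ANY completion `(u₂, u₃)` of `g` to a regular system, the weighted ideal `W((u₃,u₂,g);(b,b,a); n)` (`0 < b ≤ a`) equals
the `u`-free ideal `ratContactFiltration g a b n = Σ_α (g^α)·𝔪^{⌈(n − aα)/b⌉}` — tree bridge + one-flag collapse (§1).  Hence
the certificate hypothesis `f ∈ W(aν)` / `∉ W(aν+1)` of `DeltaCertificate` does not depend on the chosen `u`, and (G5) reduces to
the monomial reading (G1) `δ(Δ(f;u;g)) ≥ n/(bν) ↔ f ∈ W((u₃,u₂,g);(b,b,a); …)`. -/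

section FrameIndependence

variable {S : Type u} [CommRing S] [IsLocalRing S]

/-- [OURS · R9 · (G5)] `W((u₃,u₂,g);(b,b,a);n) = ratContactFiltration g a b n` for every regular-system completion `(u₂,u₃)` of `g`
(`0 < b ≤ a`). [folklore] -/
theorem weightedMonomialIdeal_eq_ratContactFiltration {g u₂ u₃ : S} {a b : ℕ}
    (h𝔪 : Ideal.span {u₃, u₂, g} = maximalIdeal S) (hb : 0 < b) (hba : b ≤ a) (n : ℕ) :
    weightedMonomialIdeal ![u₃, u₂, g] ![b, b, a] n = ratContactFiltration g a b n := by
  have hu₂ : u₂ ∈ maximalIdeal S := by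
    rw [← h𝔪]; exact Ideal.subset_span (by simp)
  rw [← flagContactFiltration_eq_weightedMonomialIdeal h𝔪 hb le_rfl hba n,
    flagContactFiltration_eq_ratContactFiltration hu₂ hb n]

/-- [OURS · R9 · (G5)] … so two completions give the SAME weighted ideal: the certificate is frame-independent in `u`. [folklore] -/
theorem weightedMonomialIdeal_frame_independent {g u₂ u₃ u₂' u₃' : S} {a b : ℕ}
    (h𝔪 : Ideal.span {u₃, u₂, g} = maximalIdeal S) (h𝔪' : Ideal.span {u₃', u₂', g} = maximalIdeal S)
    (hb : 0 < b) (hba : b ≤ a) (n : ℕ) :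
    weightedMonomialIdeal ![u₃, u₂, g] ![b, b, a] n = weightedMonomialIdeal ![u₃', u₂', g] ![b, b, a] n := by
  rw [weightedMonomialIdeal_eq_ratContactFiltration h𝔪 hb hba n,
    weightedMonomialIdeal_eq_ratContactFiltration h𝔪' hb hba n]

end FrameIndependence

end RatContact

end Iota3

end Summit.ResolutionOfSingularities.ResolutionOfSingularities.Cruxes.HypersurfaceCentreConstruction.LocalEngine
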